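import Literature.MathematicalPhysics.PowerSystems.NonuniformKuramotoConnectivityCondition
import HarnessLib

/-!
# Grounded Laplacian ⇒ the variational connectivity certificate («GROUND-AND-CHOLESKY», typing task T-L2)

Venture GRIDFUSION (file under Summits/Ventures/GridStability/Lyapunov/ — a VENTURE-side bridge lemma next to the Literature
theorem `Literature.MathematicalPhysics.PowerSystems.connectivity_certificate_of_posSemidef` it feeds), G2-SCALE cell, lead g19 RULING «GROUND-AND-CHOLESKY» (HOME STATUS l.10042 §2 (L2)); seat
gridfusion-sos-5 (g9). For a symmetric weight kernel `a : Fin (m+1) → Fin (m+1) → ℝ` (the weighted Laplacian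
`L(a)`, `zᵀL(a)z = ½ΣᵢΣⱼ aᵢⱼ(zᵢ − zⱼ)²`) and ANY grounded node `g`, positive semidefiniteness of the GROUNDED matrix
`L(a)_g − λ·I` (principal submatrix of `L(a)` with row and column `g` deleted, `λ ≥ 0`) implies the variational
connectivity hypothesis `∀ z, λ·‖Hz‖₂² ≤ (m+1)·zᵀL(a)z` (`‖Hz‖₂² = pairNormSq z = (m+1)Σzᵢ² − (Σzᵢ)²`) that
`connectivity_certificate_of_posSemidef` / `lyapW_deriv_le` / `two_norm_cohesive` / `DroopNetwork.disagreement_decay`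
consume — so a SPARSE certificate (an `LDLᵀ` / integer Cholesky of the `m × m` grounded matrix in clique-tree order,
`≈ N·(w+1)` entries, `w = 1` on a radial feeder ⇒ linear in `N`) replaces the dense `n × n` certificate of
`connectivityMatrix a λ`. The price is the constant: the best `λ` here is `λ_min(L_g) ≤ λ₂(L)` (Cauchy interlacing).

PROOF (ten lines of algebra, no spectral theory): shift `w := z − z_g·𝟙` (both sides are shift-invariant:
`zᵀLz = wᵀLw` since only differences enter, `pairNormSq z = pairNormSq w`); `w_g = 0`, so `wᵀLw` is the grounded
quadratic form at `u := w ∘ g.succAbove` and `Σᵢ wᵢ² = Σ_k u_k²`; hence `wᵀLw ≥ λΣwᵢ²`, and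
`pairNormSq w = (m+1)Σwᵢ² − (Σwᵢ)² ≤ (m+1)Σwᵢ²` finishes (this last step uses `λ ≥ 0`).

THREE COLUMNS. CERTIFIED (kernel): `grounded_energy_eq` (the grounded quadratic form IS the Laplacian energy on
vectors vanishing at `g`), `connectivity_certificate_of_grounded_quadForm` (hypothesis = the grounded quadratic-form
inequality on `{w | w g = 0}`), `connectivity_certificate_of_grounded_posSemidef` (hypothesis = `Matrix.PosSemidef
(groundedLaplacian a g lam)`, the `m × m` matrix a kernel certificate will target). VALIDATED: nothing. MODELLED:
nothing — pure linear algebra over `ℝ`; `a` need not be nonnegative for the implication (symmetry only).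

presearch: «grounded Laplacian / Dirichlet Laplacian; Cauchy interlacing λ_min(L_g) ≤ λ₂(L)» → [corpus: arXiv:1102.2950
(Dörfler–Bullo, Kron reduction) p.13 §2.6 / Thm 3.5 spectral interlacing of grounded and reduced Laplacians]; tree:
`KronReductionGroundedLaplacian.lean` (lit-1: the AUGMENTED grounded matrix `Q̂`, a different object — ground as an extra node),
`KronReductionSpectralInterlacing.lean` (λ₂ interlacing under Kron reduction); Mathlib has no principal-submatrix
`PosSemidef` interlacing lemma we could cite by name — none needed, the statement below is proved directly.
[cite: DorflerBullo2012, arXiv:0910.5673 §5.2 Lemma 5.9 (the certified inequality); DorflerBullo2013, arXiv:1102.2950 §2.6 (grounded Laplacian)]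
-/

namespace Summit.Ventures.GridStability.Lyapunov

open Finset Matrix
open Literature.MathematicalPhysics.PowerSystems

variable {m : ℕ}

/-- The GROUNDED shifted Laplacian at node `g`: the `m × m` principal submatrix of `L(a) − λ·I` with row and column `g`
deleted, indexed through `g.succAbove : Fin m ↪ Fin (m+1)`; diagonal `Σ_k a_{ik} − λ` (the FULL weighted degree, the
edge to the grounded node included), off-diagonal `−a_{ij}`. [cite: DorflerBullo2013, arXiv:1102.2950 §2.6 (grounded / loopy Laplacian)] -/
def groundedLaplacian (a : Fin (m + 1) → Fin (m + 1) → ℝ) (g : Fin (m + 1)) (lam : ℝ) :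
    Matrix (Fin m) (Fin m) ℝ :=
  Matrix.of fun i j =>
    (if i = j then (∑ k, a (g.succAbove i) k) - lam else 0) - a (g.succAbove i) (g.succAbove j)

/-- The Laplacian energy `½ΣΣ aᵢⱼ(zᵢ − zⱼ)²` is invariant under a common shift of all entries. [folklore] -/
theorem laplacianEnergy_shift (a : Fin (m + 1) → Fin (m + 1) → ℝ) (z : Fin (m + 1) → ℝ) (c : ℝ) :
    (1 / 2 : ℝ) * ∑ i, ∑ j, a i j * ((z i - c) - (z j - c)) ^ 2
      = 1 / 2 * ∑ i, ∑ j, a i j * (z i - z j) ^ 2 := by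
  congr 1
  exact Finset.sum_congr rfl fun i _ => Finset.sum_congr rfl fun j _ => by ring

/-- `pairNormSq` is invariant under a common shift of all entries. [folklore] -/
theorem pairNormSq_shift (z : Fin (m + 1) → ℝ) (c : ℝ) :
    pairNormSq (fun i => z i - c) = pairNormSq z := by
  unfold pairNormSq
  congr 1
  exact Finset.sum_congr rfl fun i _ => Finset.sum_congr rfl fun j _ => by ring

/-- **The grounded quadratic form is the Laplacian energy on vectors vanishing at the grounded node**: for `w` with
`w g = 0` and `u = w ∘ g.succAbove`, `uᵀ(L_g − λI)u = ½ΣΣ aᵢⱼ(wᵢ − wⱼ)² − λ Σᵢ wᵢ²` (symmetric `a`). [folklore] -/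
theorem grounded_energy_eq (a : Fin (m + 1) → Fin (m + 1) → ℝ) (ha : ∀ i j, a i j = a j i)
    (g : Fin (m + 1)) (lam : ℝ) (w : Fin (m + 1) → ℝ) (hw : w g = 0) :
    dotProduct (fun k => w (g.succAbove k)) ((groundedLaplacian a g lam).mulVec fun k => w (g.succAbove k))
      = 1 / 2 * ∑ i, ∑ j, a i j * (w i - w j) ^ 2 - lam * ∑ i, w i ^ 2 := by
  -- the full-index bilinear expression Σᵢ wᵢ (Σⱼ aᵢⱼ (wᵢ − wⱼ) − λ wᵢ)
  have hfull : ∑ i, w i * ((∑ j, a i j * (w i - w j)) - lam * w i)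
      = 1 / 2 * ∑ i, ∑ j, a i j * (w i - w j) ^ 2 - lam * ∑ i, w i ^ 2 := by
    rw [sum_sum_mul_sub_sq a ha w]
    have : ∀ i, w i * ((∑ j, a i j * (w i - w j)) - lam * w i)
        = w i * ∑ j, a i j * (w i - w j) - lam * w i ^ 2 := fun i => by ring
    simp_rw [this]
    rw [Finset.sum_sub_distrib, ← Finset.mul_sum]
    ring
  rw [← hfull]
  -- split the outer sum at `g` (its term vanishes since `w g = 0`) and identify the grounded rows
  rw [Fin.sum_univ_succAbove _ g, hw, zero_mul, zero_add]
  simp only [dotProduct]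
  refine Finset.sum_congr rfl fun k _ => ?_
  congr 1
  simp only [Matrix.mulVec, dotProduct, groundedLaplacian, Matrix.of_apply]
  -- row `g.succAbove k`: Σ_l [(δ_{kl}(deg − λ)) − a] u_l = (deg − λ) u_k − Σ_l a_{k l} u_l over l ≠ g
  have hsplit : ∑ l : Fin m, ((if k = l then (∑ t, a (g.succAbove k) t) - lam else 0)
        - a (g.succAbove k) (g.succAbove l)) * w (g.succAbove l)
      = ((∑ t, a (g.succAbove k) t) - lam) * w (g.succAbove k)
        - ∑ l : Fin m, a (g.succAbove k) (g.succAbove l) * w (g.succAbove l) := by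
    have h1 : ∀ l : Fin m, ((if k = l then (∑ t, a (g.succAbove k) t) - lam else 0)
          - a (g.succAbove k) (g.succAbove l)) * w (g.succAbove l)
        = (if k = l then ((∑ t, a (g.succAbove k) t) - lam) * w (g.succAbove l) else 0)
          - a (g.succAbove k) (g.succAbove l) * w (g.succAbove l) := fun l => by split_ifs <;> ring
    simp_rw [h1]
    rw [Finset.sum_sub_distrib, Finset.sum_ite_eq Finset.univ k, if_pos (Finset.mem_univ k)]
  rw [hsplit]
  -- the full-index sum Σⱼ a_{ij}(wᵢ − wⱼ) with i = g.succAbove k, split at j = g (w g = 0)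
  have hj : ∑ j, a (g.succAbove k) j * (w (g.succAbove k) - w j)
      = a (g.succAbove k) g * w (g.succAbove k)
        + ∑ l : Fin m, a (g.succAbove k) (g.succAbove l) * (w (g.succAbove k) - w (g.succAbove l)) := by
    rw [Fin.sum_univ_succAbove _ g, hw, sub_zero]
  have hdeg : ∑ t, a (g.succAbove k) t = a (g.succAbove k) g + ∑ l : Fin m, a (g.succAbove k) (g.succAbove l) := by
    rw [Fin.sum_univ_succAbove _ g]
  rw [hj, hdeg]
  have h2 : ∑ l : Fin m, a (g.succAbove k) (g.succAbove l) * (w (g.succAbove k) - w (g.succAbove l))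
      = (∑ l : Fin m, a (g.succAbove k) (g.succAbove l)) * w (g.succAbove k)
        - ∑ l : Fin m, a (g.succAbove k) (g.succAbove l) * w (g.succAbove l) := by
    rw [Finset.sum_mul, ← Finset.sum_sub_distrib]
    exact Finset.sum_congr rfl fun l _ => by ring
  rw [h2]
  ring

/-- **T-L2, quadratic-form version.** If the grounded energy inequality `λ Σᵢ wᵢ² ≤ ½ΣΣ aᵢⱼ(wᵢ − wⱼ)²` holds
for every `w` vanishing at the grounded node `g` (i.e. `L_g − λI ⪰ 0` as a quadratic form) and `λ ≥ 0`, then the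
variational connectivity certificate `λ‖Hz‖₂² ≤ (m+1)·½ΣΣ aᵢⱼ(zᵢ − zⱼ)²` holds for EVERY `z` — the hypothesis of
`connectivity_certificate_of_posSemidef`'s consumers. [cite: DorflerBullo2012, arXiv:0910.5673 §5.2 Lemma 5.9; DorflerBullo2013, arXiv:1102.2950 §2.6] -/
theorem connectivity_certificate_of_grounded_quadForm (a : Fin (m + 1) → Fin (m + 1) → ℝ)
    (g : Fin (m + 1)) (lam : ℝ) (hlam : 0 ≤ lam)
    (hG : ∀ w : Fin (m + 1) → ℝ, w g = 0 → lam * ∑ i, w i ^ 2 ≤ 1 / 2 * ∑ i, ∑ j, a i j * (w i - w j) ^ 2) :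
    ∀ z : Fin (m + 1) → ℝ,
      lam * pairNormSq z ≤ ((m + 1 : ℕ) : ℝ) * (1 / 2 * ∑ i, ∑ j, a i j * (z i - z j) ^ 2) := by
  intro z
  set w : Fin (m + 1) → ℝ := fun i => z i - z g with hwdef
  have hwg : w g = 0 := by simp [hwdef]
  have hE : (1 / 2 : ℝ) * ∑ i, ∑ j, a i j * (z i - z j) ^ 2 = 1 / 2 * ∑ i, ∑ j, a i j * (w i - w j) ^ 2 := by
    rw [hwdef]; exact (laplacianEnergy_shift a z (z g)).symm
  have hP : pairNormSq z = pairNormSq w := by rw [hwdef]; exact (pairNormSq_shift z (z g)).symm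
  rw [hE, hP, pairNormSq_eq]
  have h1 := hG w hwg
  have h2 : 0 ≤ (∑ i, w i) ^ 2 := sq_nonneg _
  have h3 : 0 ≤ ∑ i, w i ^ 2 := Finset.sum_nonneg fun i _ => sq_nonneg _
  have hn : (0 : ℝ) ≤ ((m + 1 : ℕ) : ℝ) := by positivity
  nlinarith [mul_le_mul_of_nonneg_left h1 hn, mul_nonneg hlam h2]

/-- **T-L2 («GROUND-AND-CHOLESKY»), matrix version.** If the `m × m` grounded matrix `groundedLaplacian a g λ =
L(a)_g − λI` is positive semidefinite (symmetric weights `a`, any grounded node `g`, `λ ≥ 0`), then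
`∀ z, λ·pairNormSq z ≤ (m+1)·½ΣΣ aᵢⱼ(zᵢ − zⱼ)²` — exactly the conclusion of `connectivity_certificate_of_posSemidef`,
obtained from a SPARSE certificate (the grounded matrix keeps the graph's sparsity; its `LDLᵀ` in clique-tree order
has `≈ N(w+1)` entries). The best admissible `λ` is `λ_min(L_g) ≤ λ₂(L)` (Cauchy interlacing; grounding near the
middle of a path costs ≈ ×1, at an end ≈ ×4). [cite: DorflerBullo2012, arXiv:0910.5673 §5.2 Lemma 5.9; DorflerBullo2013, arXiv:1102.2950 §2.6] -/
theorem connectivity_certificate_of_grounded_posSemidef (a : Fin (m + 1) → Fin (m + 1) → ℝ)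
    (ha : ∀ i j, a i j = a j i) (g : Fin (m + 1)) (lam : ℝ) (hlam : 0 ≤ lam)
    (hQ : Matrix.PosSemidef (groundedLaplacian a g lam)) :
    ∀ z : Fin (m + 1) → ℝ,
      lam * pairNormSq z ≤ ((m + 1 : ℕ) : ℝ) * (1 / 2 * ∑ i, ∑ j, a i j * (z i - z j) ^ 2) := by
  refine connectivity_certificate_of_grounded_quadForm a g lam hlam fun w hw => ?_
  have h := hQ.dotProduct_mulVec_nonneg (fun k => w (g.succAbove k))
  have h' : 0 ≤ dotProduct (fun k => w (g.succAbove k))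
      ((groundedLaplacian a g lam).mulVec fun k => w (g.succAbove k)) := by simpa using h
  rw [grounded_energy_eq a ha g lam w hw] at h'
  linarith

end Summit.Ventures.GridStability.Lyapunov
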